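import Summits.MatrixMultiplication.OmegaCensus.STPPVosperSlackOnePairing

/-!
# ω-census (abelian STPP census): the A-pairing of `W` with HOLES and general `A`-shapes — an exact-cover-up-to-`k`-points test and its soundness (kernel)

HONEST FRAMING (pub-omega census; verbatim): lottery ticket; floor = certified bounds/negative ranges.
Census STRUCTURE (seat pub-omega-stpp-2 gen 26, 2026-08-28), family (b2).  `STPPVosperSlackOnePairing.lean` tests that a set of residues is an EXACT
disjoint union of translates of the combined `(A,B)`-pattern of a block (slack one: `W` is exactly the window complement).  With slack `s ≥ 2`
(seat stpp-1 gen 32, HOME `pub-omega-stpp-1-g32/SLACK2-DESIGN.md`, test (i) of the proposed partition law) one only knows a set `R ⊇ W` with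
`#R ≤ #W + k`, and after Hamidoune–Rødseth the set `−Aᵢ` may be a progression with a hole.  This file provides the corresponding tool:
* `patN2 p j AD BD` — the combined pattern `{ε·j − δ : ε ∈ AD, δ ∈ BD}` for arbitrary index sets (`patN p j a BD = patN2 p j (range a) BD`);
* `coverByFk p T fuel k X` — is `X` a disjoint union of translates of `T` modulo `p` together with at most `k` further points? (`Bool`; the minimum of `X`
  is either a hole or covered by a tile through it) and its soundness `coverByFk_of_tiling`;
* `coverByFk_blockSum2` — for an STPP family whose block `i` has `−Aᵢ = {s₀ + ε•d : ε ∈ AD}`, `Bᵢ = {β + δ•e′ : δ ∈ BD}`, `u e′ = 1`, and any `R ⊇ W`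
  with `#R ≤ #W + k`: the values of `u·R + w` pass `coverByFk` with the pattern `patN2 p (u d).val AD BD` — UNCONDITIONAL.
Nothing here is progress on `ω`.

References: H. Cohn, R. Kleinberg, B. Szegedy, C. Umans, FOCS 2005 (arXiv:math/0511460), Def. 5.1.
-/

open Finset
open scoped Pointwise

namespace Summit.MatrixMultiplication.OmegaCensus.CubeNB

open Literature.Computability.AlgebraicComplexity
open Literature.Combinatorics.Additive
open Summit.MatrixMultiplication.OmegaCensus.STPPKneser

/-! ## §1 The test with holes -/

section CoverByK

/-- The combined `(A,B)`-pattern for general index sets: `{(ε·j − δ) mod p : ε ∈ AD, δ ∈ BD}`. [folklore] -/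
def patN2 (p j : ℕ) (AD BD : Finset ℕ) : Finset ℕ := (AD ×ˢ BD).image fun εδ : ℕ × ℕ => ((εδ.1 * j) % p + p - εδ.2) % p

/-- `patN` is `patN2` over the full index range. [folklore] -/
theorem patN_eq_patN2 (p j a : ℕ) (BD : Finset ℕ) : patN p j a BD = patN2 p j (range a) BD := rfl

/-- **Exact cover up to `k` points modulo `p`.**  `coverByFk p T fuel k X`: is `X` the disjoint union of (at most `fuel`, counting holes) translates
`(g + T) mod p` and at most `k` further points ("holes")?  The minimum of `X` is a hole or lies in a tile; branch accordingly. (`Bool`.) [folklore] -/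
def coverByFk (p : ℕ) (T : Finset ℕ) : ℕ → ℕ → Finset ℕ → Bool
  | 0, _, X => decide (X = ∅)
  | fuel + 1, k, X =>
    if h : X.Nonempty then
      (decide (0 < k) && coverByFk p T fuel (k - 1) (X.erase (X.min' h))) ||
      decide (∃ g ∈ T, T.image (fun t => ((X.min' h + p - g) % p + t) % p) ⊆ X ∧
        coverByFk p T fuel k (X \ T.image fun t => ((X.min' h + p - g) % p + t) % p) = true)
    else true

/-- **Soundness of the test with holes.**  If `X = ⋃_{i ∈ s} ((g i + T) mod p) ∪ HS` with pairwise disjoint tiles, `HS` disjoint from every tile,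
`g i < p`, every `t ∈ T` below `p`, `#HS ≤ k` and `#s + #HS ≤ fuel`, then `coverByFk p T fuel k X = true`. [folklore] -/
theorem coverByFk_of_tiling (p : ℕ) (T : Finset ℕ) (hT : ∀ t ∈ T, t < p) {ι : Type*} [DecidableEq ι] (g : ι → ℕ) :
    ∀ (fuel k : ℕ) (s : Finset ι) (HS : Finset ℕ), #s + #HS ≤ fuel → #HS ≤ k → (∀ i ∈ s, g i < p) →
      (s : Set ι).PairwiseDisjoint (fun i => T.image fun t => (g i + t) % p) →
      (∀ i ∈ s, Disjoint (T.image fun t => (g i + t) % p) HS) →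
      coverByFk p T fuel k ((s.biUnion fun i => T.image fun t => (g i + t) % p) ∪ HS) = true := by
  intro fuel
  induction fuel with
  | zero =>
    intro k s HS hf _ _ _ _
    have hs : s = ∅ := Finset.card_eq_zero.1 (by omega)
    have hH : HS = ∅ := Finset.card_eq_zero.1 (by omega)
    rw [hs, hH, Finset.biUnion_empty, Finset.empty_union]
    simp [coverByFk]
  | succ f ih =>
    intro k s HS hf hk hg hdisj hdisjH
    set X := (s.biUnion fun i => T.image fun t => (g i + t) % p) ∪ HS with hX
    by_cases hne : X.Nonempty
    · rw [coverByFk, dif_pos hne, Bool.or_eq_true]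
      set x₀ := X.min' hne with hx₀
      have hx₀mem : x₀ ∈ X := Finset.min'_mem X hne
      rcases Finset.mem_union.1 hx₀mem with hx₀T | hx₀H
      · -- the minimum lies in a tile
        right
        rw [decide_eq_true_eq]
        obtain ⟨i₀, hi₀, hx₀i⟩ := Finset.mem_biUnion.1 hx₀T
        obtain ⟨t₀, ht₀, hx₀t⟩ := Finset.mem_image.1 hx₀i
        have hgi₀ : g i₀ < p := hg i₀ hi₀
        have ht₀p : t₀ < p := hT t₀ ht₀
        have hctr : (x₀ + p - t₀) % p = g i₀ := by
          rw [← hx₀t]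
          have h1 : (g i₀ + t₀) % p + p - t₀ = (g i₀ + t₀) % p + (p - t₀) := by omega
          rw [h1, Nat.add_mod, Nat.mod_mod, ← Nat.add_mod, show g i₀ + t₀ + (p - t₀) = g i₀ + p by omega, Nat.add_mod_right,
            Nat.mod_eq_of_lt hgi₀]
        refine ⟨t₀, ht₀, ?_, ?_⟩
        · rw [hctr]
          exact (Finset.subset_biUnion_of_mem (fun i => T.image fun t => (g i + t) % p) hi₀).trans Finset.subset_union_left
        · have hrest : X \ T.image (fun t => ((x₀ + p - t₀) % p + t) % p) =
              ((s.erase i₀).biUnion fun i => T.image fun t => (g i + t) % p) ∪ HS := by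
            rw [hctr, hX, ← Finset.insert_erase hi₀, Finset.biUnion_insert, Finset.insert_erase hi₀, Finset.union_assoc,
              Finset.union_sdiff_left, Finset.sdiff_eq_self_iff_disjoint, Finset.disjoint_union_left, Finset.disjoint_biUnion_left]
            refine ⟨fun i hi => ?_, (hdisjH i₀ hi₀).symm⟩
            exact hdisj (Finset.mem_coe.2 (Finset.mem_of_mem_erase hi)) (Finset.mem_coe.2 hi₀) (Finset.ne_of_mem_erase hi)
          rw [hrest]
          have hspos : 0 < #s := Finset.card_pos.2 ⟨i₀, hi₀⟩
          apply ih
          · rw [Finset.card_erase_of_mem hi₀]; omega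
          · exact hk
          · exact fun i hi => hg i (Finset.mem_of_mem_erase hi)
          · exact hdisj.subset (Finset.coe_subset.2 (Finset.erase_subset i₀ s))
          · exact fun i hi => hdisjH i (Finset.mem_of_mem_erase hi)
      · -- the minimum is a hole
        left
        rw [Bool.and_eq_true, decide_eq_true_eq]
        have hHpos : 0 < #HS := Finset.card_pos.2 ⟨x₀, hx₀H⟩
        refine ⟨lt_of_lt_of_le hHpos hk, ?_⟩
        have hrest : X.erase x₀ = (s.biUnion fun i => T.image fun t => (g i + t) % p) ∪ HS.erase x₀ := by
          rw [hX, Finset.erase_union_distrib]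
          congr 1
          rw [Finset.erase_eq_of_notMem]
          intro hmem
          obtain ⟨i, hi, hxi⟩ := Finset.mem_biUnion.1 hmem
          exact Finset.disjoint_left.1 (hdisjH i hi) hxi hx₀H
        rw [hrest]
        apply ih
        · rw [Finset.card_erase_of_mem hx₀H]; omega
        · rw [Finset.card_erase_of_mem hx₀H]; omega
        · exact hg
        · exact hdisj
        · exact fun i hi => (hdisjH i hi).mono_right (Finset.erase_subset _ _)
    · rw [coverByFk, dif_neg hne]

end CoverByK

/-! ## §2 Transport from `ℤ/pℤ` -/

section Transport

variable {p : ℕ} [hp : Fact p.Prime]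

/-- **Transport of a tiling with extra points.**  Pairwise disjoint translates `gz i + TZ` (`i ∈ s`) and a finite set `HZ` disjoint from them, with
`#HZ ≤ k` and `#s + #HZ ≤ fuel`: the values of the union pass `coverByFk`. [folklore] -/
theorem coverByFk_of_zmod_tiling (TZ : Finset (ZMod p)) {ι : Type*} [DecidableEq ι] (s : Finset ι) (gz : ι → ZMod p) (HZ : Finset (ZMod p))
    {fuel k : ℕ} (hfuel : #s + #HZ ≤ fuel) (hk : #HZ ≤ k)
    (hdisj : (s : Set ι).PairwiseDisjoint fun i => TZ.image fun τ => gz i + τ) (hdisjH : ∀ i ∈ s, Disjoint (TZ.image fun τ => gz i + τ) HZ) :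
    coverByFk p (TZ.image ZMod.val) fuel k (((s.biUnion fun i => TZ.image fun τ => gz i + τ) ∪ HZ).image ZMod.val) = true := by
  have hvinj := ZMod.val_injective p
  have himg : ((s.biUnion fun i => TZ.image fun τ => gz i + τ) ∪ HZ).image ZMod.val =
      (s.biUnion fun i => (TZ.image ZMod.val).image fun t => ((gz i).val + t) % p) ∪ HZ.image ZMod.val := by
    rw [Finset.image_union, Finset.biUnion_image]
    congr 1
    exact Finset.biUnion_congr rfl fun i _ => image_val_translate TZ (gz i)
  rw [himg]
  refine coverByFk_of_tiling p (TZ.image ZMod.val) (fun t ht => ?_) (fun i => (gz i).val) fuel k s (HZ.image ZMod.val)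
    (by rw [Finset.card_image_of_injective _ hvinj]; exact hfuel) (by rw [Finset.card_image_of_injective _ hvinj]; exact hk)
    (fun i _ => ZMod.val_lt _) ?_ ?_
  · obtain ⟨τ, -, rfl⟩ := Finset.mem_image.1 ht
    exact ZMod.val_lt τ
  · intro i hi i' hi' hne
    have h := hdisj hi hi' hne
    rw [Function.onFun] at h ⊢
    rw [← image_val_translate, ← image_val_translate]
    exact (Finset.disjoint_image hvinj).2 h
  · intro i hi
    rw [← image_val_translate]
    exact (Finset.disjoint_image hvinj).2 (hdisjH i hi)

variable {N : ℕ} {A B C : Fin N → Finset (ZMod p)}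

/-- **Transport of one `C`-tile, general shapes.**  With `−Aᵢ = {s₀ + ε•d : ε ∈ AD}`, `Bᵢ = {β + δ•e′ : δ ∈ BD}` and `u e′ = 1`:
`u·(c − Aᵢ − Bᵢ) + w = (u c + w + u s₀ − u β) + {ε·(u d) − δ}`. [folklore] -/
theorem image_Ctile_affine2 (i : Fin N) {u e' d s₀ β w : ZMod p} (hue : u * e' = 1) {AD BD : Finset ℕ}
    (hSn : (A i).image (fun x => (0 : ZMod p) - x) = AD.image fun ε : ℕ => s₀ + ε • d) (hB : B i = BD.image fun δ : ℕ => β + δ • e')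
    (c : ZMod p) :
    (((A i) ×ˢ (B i)).image fun ab : ZMod p × ZMod p => (0 : ZMod p) + c - ab.1 - ab.2).image (fun x => u * x + w) =
      ((AD ×ˢ BD).image fun εδ : ℕ × ℕ => (εδ.1 : ZMod p) * (u * d) - (εδ.2 : ZMod p)).image
        fun τ => (u * c + w + u * s₀ - u * β) + τ := by
  ext x
  simp only [Finset.mem_image, Finset.mem_product, Prod.exists]
  constructor
  · rintro ⟨y, ⟨a', b', ⟨ha', hb'⟩, rfl⟩, rfl⟩
    have hs : (0 : ZMod p) - a' ∈ AD.image (fun ε : ℕ => s₀ + ε • d) := by rw [← hSn]; exact Finset.mem_image.2 ⟨a', ha', rfl⟩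
    obtain ⟨ε, hε, hεs⟩ := Finset.mem_image.1 hs
    rw [hB] at hb'
    obtain ⟨δ, hδ, rfl⟩ := Finset.mem_image.1 hb'
    refine ⟨(ε : ZMod p) * (u * d) - (δ : ZMod p), ⟨ε, δ, ⟨hε, hδ⟩, rfl⟩, ?_⟩
    have h1 : (0 : ZMod p) - a' = s₀ + ε • d := hεs.symm
    rw [nsmul_eq_mul] at h1
    rw [nsmul_eq_mul]
    linear_combination (-u) * h1 + (δ : ZMod p) * hue
  · rintro ⟨τ, ⟨ε, δ, ⟨hε, hδ⟩, rfl⟩, rfl⟩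
    have hs : s₀ + ε • d ∈ (A i).image (fun x => (0 : ZMod p) - x) := by rw [hSn]; exact Finset.mem_image.2 ⟨ε, hε, rfl⟩
    obtain ⟨a', ha', ha's⟩ := Finset.mem_image.1 hs
    refine ⟨(0 : ZMod p) + c - a' - (β + δ • e'), ⟨a', β + δ • e', ⟨ha', by rw [hB]; exact Finset.mem_image.2 ⟨δ, hδ, rfl⟩⟩, rfl⟩, ?_⟩
    have h1 : (0 : ZMod p) - a' = s₀ + ε • d := ha's
    rw [nsmul_eq_mul] at h1
    rw [nsmul_eq_mul]
    linear_combination u * h1 - (δ : ZMod p) * hue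

/-- Values of the general combined pattern. [folklore] -/
theorem image_val_pattern2 {u d : ZMod p} {AD BD : Finset ℕ} (hAD : ∀ ε ∈ AD, ε < p) (hBD : ∀ δ ∈ BD, δ < p) :
    ((AD ×ˢ BD).image fun εδ : ℕ × ℕ => (εδ.1 : ZMod p) * (u * d) - (εδ.2 : ZMod p)).image ZMod.val = patN2 p (u * d).val AD BD := by
  rw [patN2, Finset.image_image]
  refine Finset.image_congr fun εδ hεδ => ?_
  obtain ⟨hε, hδ⟩ := Finset.mem_product.1 (Finset.mem_coe.1 hεδ)
  simp only [Function.comp_apply]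
  rw [val_sub_eq_mod, ZMod.val_mul, ZMod.val_natCast, ZMod.val_natCast, Nat.mod_eq_of_lt (hAD _ hε), Nat.mod_eq_of_lt (hBD _ hδ)]

/-- **The A-pairing of `W` with holes (transported).**  For an STPP family and a block `i` with `−Aᵢ = {s₀ + ε•d : ε ∈ AD}`, `Bᵢ = {β + δ•e′ : δ ∈ BD}`
(`AD`, `BD` below `p`), `u e′ = 1`, and a set `R ⊇ W` of residues with `#R ≤ #W + k` and `#Cᵢ + k ≤ fuel`: the values of `u·R + w` pass the exact
cover test with at most `k` holes and the pattern `patN2 p (u d).val AD BD`. [cite: CohnKleinbergSzegedyUmans2005, Def. 5.1] -/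
theorem coverByFk_blockSum2 (hS : IsSTPP A B C) (i : Fin N) {u e' d s₀ β w : ZMod p} (hue : u * e' = 1) {AD BD : Finset ℕ}
    (hAD : ∀ ε ∈ AD, ε < p) (hBD : ∀ δ ∈ BD, δ < p)
    (hSn : (A i).image (fun x => (0 : ZMod p) - x) = AD.image fun ε : ℕ => s₀ + ε • d) (hB : B i = BD.image fun δ : ℕ => β + δ • e')
    {R : Finset (ZMod p)} {k fuel : ℕ}
    (hWR : (((A i) ×ˢ ((B i) ×ˢ (C i))).image fun q : ZMod p × ZMod p × ZMod p => (0 : ZMod p) + q.2.2 - q.1 - q.2.1) ⊆ R)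
    (hRk : #R ≤ #((((A i) ×ˢ ((B i) ×ˢ (C i))).image fun q : ZMod p × ZMod p × ZMod p => (0 : ZMod p) + q.2.2 - q.1 - q.2.1)) + k)
    (hfuel : #(C i) + k ≤ fuel) :
    coverByFk p (patN2 p (u * d).val AD BD) fuel k ((R.image fun x => u * x + w).image ZMod.val) = true := by
  set W := ((A i) ×ˢ ((B i) ×ˢ (C i))).image fun q : ZMod p × ZMod p × ZMod p => (0 : ZMod p) + q.2.2 - q.1 - q.2.1 with hW
  obtain ⟨hWeq, hdisj⟩ := W_eq_biUnion_C hS i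
  rw [← hW] at hWeq
  set TZ := (AD ×ˢ BD).image fun εδ : ℕ × ℕ => (εδ.1 : ZMod p) * (u * d) - (εδ.2 : ZMod p) with hTZ
  set gz : ZMod p → ZMod p := fun c => u * c + w + u * s₀ - u * β with hgz
  have hu0 : u ≠ 0 := fun h => by rw [h, zero_mul] at hue; exact zero_ne_one hue
  have hφinj : Function.Injective (fun x : ZMod p => u * x + w) := affine_injective hu0 w
  have htiles : W.image (fun x => u * x + w) = (C i).biUnion fun c => TZ.image fun τ => gz c + τ := by
    rw [hWeq, Finset.biUnion_image]
    exact Finset.biUnion_congr rfl fun c _ => image_Ctile_affine2 i hue hSn hB c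
  have hdisjT : ((C i : Finset (ZMod p)) : Set (ZMod p)).PairwiseDisjoint fun c => TZ.image fun τ => gz c + τ := by
    intro c hc c' hc' hne
    rw [Function.onFun, ← image_Ctile_affine2 i hue hSn hB c, ← image_Ctile_affine2 i hue hSn hB c']
    exact (Finset.disjoint_image hφinj).2 (hdisj hc hc' hne)
  -- the holes
  set HZ := (R \ W).image (fun x => u * x + w) with hHZ
  have hRE : R.image (fun x => u * x + w) = (C i).biUnion (fun c => TZ.image fun τ => gz c + τ) ∪ HZ := by
    rw [← htiles, hHZ, ← Finset.image_union, Finset.union_sdiff_of_subset hWR]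
  have hHZcard : #HZ ≤ k := by
    rw [hHZ, Finset.card_image_of_injective _ hφinj, Finset.card_sdiff_of_subset hWR]; omega
  have hdisjH : ∀ c ∈ C i, Disjoint (TZ.image fun τ => gz c + τ) HZ := by
    intro c hc
    rw [← image_Ctile_affine2 i hue hSn hB c, hHZ, Finset.disjoint_image hφinj]
    refine Finset.disjoint_left.2 fun x hx hx' => (Finset.mem_sdiff.1 hx').2 ?_
    rw [hWeq]
    exact Finset.mem_biUnion.2 ⟨c, hc, hx⟩
  rw [hRE, ← image_val_pattern2 hAD hBD]
  exact coverByFk_of_zmod_tiling TZ (C i) gz HZ (by omega) hHZcard hdisjT hdisjH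

end Transport

end Summit.MatrixMultiplication.OmegaCensus.CubeNB
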